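import Literature.NumberTheory.LFunctions.RiemannSiegelAuxiliary
import Literature.NumberTheory.LFunctions.AFECoefficient
import Literature.NumberTheory.LFunctions.PowerOscillatoryIntegrals
import Literature.NumberTheory.LFunctions.ZetaSubconvexity
import Literature.NumberTheory.LFunctions.ZetaSqReflectionPrinciple
import Mathlib.Analysis.PSeries
import Mathlib.MeasureTheory.Integral.Prod
import Mathlib.Analysis.SpecialFunctions.Gamma.Deriv
import Mathlib.Analysis.SpecialFunctions.Trigonometric.Complex
import Mathlib.Analysis.Complex.Convex
import Mathlib.NumberTheory.LSeries.RiemannZeta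
import HarnessLib

/-!
# The Riemann–Siegel integral formula `ζ(s) = 𝓡(s) + χ(s) conj 𝓡(1−s̄)` (Siegel 1932, §3; Titchmarsh §2.10)

Topic `Literature/NumberTheory/LFunctions`. Third file of the proof of Lehman's bound
(`Literature.NumberTheory.LFunctions.Trudgian2011_lemma_2_5`). We prove Riemann's integral formula
for `ζ(s)` (Siegel 1932, eqs. (55)–(60); Titchmarsh (2.10.6); Arias de Reyna 2024, Thm. 5) in the
mirror-image conventions of `SiegelMordellIntegral.lean`:

* `Literature.NumberTheory.LFunctions.SiegelIntegral.riemannZeta_eq_riemannAux_add` — for `0 < σ < 3`, `s ≠ 1`: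
  `ζ(s) = 𝓡(s) + χ(s) K(s)`, `K(s) = conj 𝓡(1 − conj s)`
  (`Literature.NumberTheory.LFunctions.SiegelIntegral.riemannAuxConj`),
  `χ(s) = (2π)^s/(2Γ(s)cos(πs/2))` (`Literature.NumberTheory.LFunctions.SiegelIntegral.rsChi`, the closed form of
  Titchmarsh (2.1.8)–(2.1.9), literally Siegel §2 eq. (32)). This `χ` is the inverse of the tree's
  `Literature.NumberTheory.LFunctions.ZetaM4.feFactor` for every `s`
  (`Literature.NumberTheory.LFunctions.SiegelIntegral.rsChi_eq_inv_feFactor`; `ZetaSqReflectionPrinciple.lean`) and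
  equals the tree's `Literature.NumberTheory.LFunctions.riemannZetaChi` (`ZetaSubconvexity.lean`, (2.1.10)) whenever
  `sin(πs) ≠ 0` (`Literature.NumberTheory.LFunctions.SiegelIntegral.rsChi_eq_riemannZetaChi`). The closed form is
  used because `riemannZetaChi` carries Mathlib's junk value `Γ(−1) = 0` at `s = 2` (`riemannZetaChi 2 = 0`),
  while the identity is first proved on the strip `2 < σ < 3`, where the true `χ(2) = −2π²` is needed.
  Proof (Siegel §3, mirrored): multiply Riemann's evaluation of Mordell's integral
  (`mordellPsi_eq`) at `w = r(−1+i)` by `w^{s−1}` and integrate over `r ∈ (0, ∞)`; Term A is a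
  double integral evaluated by Fubini and a rotated Gamma integral (`integral_rayKernelA`,
  `= −Q(s)𝓡(s)`), Term B a geometric series of rotated Gamma integrals summing to `−Q(s)ζ(s)`
  (`integral_rayKernelB`, valid for `σ > 1`), Term C is carried onto `K(s)` by complex conjugation and
  the two-ray decomposition of the line through `0` (`integral_rayKernelC`, `riemannAuxConj_eq`,
  `σ > 2`); the identity on `2 < σ < 3` (`riemannZeta_eq_of_two_lt_re`) extends by the identity
  theorem.
* `Literature.NumberTheory.LFunctions.SiegelIntegral.norm_rsChi_half` — `|χ(½+it)| = 1` (through the bridge, from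
  `Literature.NumberTheory.LFunctions.norm_riemannZetaChi_half`), and
  `Literature.NumberTheory.LFunctions.SiegelIntegral.norm_riemannZeta_half_le_two_mul` —
  **`|ζ(½+it)| ≤ 2|𝓡(½+it)|`** (Siegel's (59)–(60)).
* `Literature.NumberTheory.LFunctions.SiegelIntegral.riemannAux_eq_sum_add_rsLineIntegral` — the residue shift
  `𝓡(s) = Σ_{n≤N} n^{-s} + J_c(s)` for `N < c < N+1` (the residue of `F_s` at `x = n` is `n^{-s}/(2πi)`).

## References

* C. L. Siegel, *Über Riemanns Nachlaß zur analytischen Zahlentheorie* (1932), §2 eq. (32),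
  §3 eqs. (55)–(60). [Siegel1932]
* E. C. Titchmarsh, *The Theory of the Riemann Zeta-Function*, 2nd ed., §2.1 (2.1.8)–(2.1.10), §2.10
  (2.10.6), §4.17 (4.17.2). [Titchmarsh1986]
-/

noncomputable section

open Complex MeasureTheory Set Filter Real
open scoped Topology ComplexConjugate

namespace Literature.NumberTheory.LFunctions

namespace SiegelIntegral

/-! ## The ray `w = r(−1+i)` of the `w`-integration and the constant `Q(s)` -/

/-- The direction `v = −1 + i` of the ray `w = rv`, `r > 0`, over which Riemann's integral
`Ψ(w)` is integrated against `w^{s−1}` (mirror image of Siegel's ray `arg u = π/4`).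
[cite: Siegel1932, §3] -/
def rayDir : ℂ := -1 + I

/-- `v = i(1+i)`. [folklore] -/
lemma rayDir_eq_I_mul : rayDir = I * (1 + I) := by
  rw [rayDir, mul_add, mul_one, I_mul_I]; ring

/-- `v ≠ 0`. [folklore] -/
lemma rayDir_ne_zero : rayDir ≠ 0 := by
  intro h; have := congrArg Complex.im h; simp [rayDir] at this

/-- `re (r v) = −r`, `im (r v) = r`. [folklore] -/
@[simp] lemma ofReal_mul_rayDir_re (r : ℝ) : ((r : ℂ) * rayDir).re = -r := by simp [rayDir]

/-- `im (r v) = r`. [folklore] -/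
@[simp] lemma ofReal_mul_rayDir_im (r : ℝ) : ((r : ℂ) * rayDir).im = r := by simp [rayDir]

/-- `v² = −2i`, so `−πi (rv)² = −2π r²`. [folklore] -/
lemma rayDir_sq : rayDir ^ 2 = -2 * I := by
  rw [rayDir, sq]; ring_nf; rw [I_sq]; ring

/-- `−i v = 1 + i`. [folklore] -/
lemma neg_I_mul_rayDir : -I * rayDir = 1 + I := by
  rw [rayDir]; ring_nf; rw [I_sq]; ring

/-- `conj v = −(1+i)`. [folklore] -/
lemma conj_rayDir : conj rayDir = -(1 + I) := by
  rw [rayDir, map_add, map_neg, map_one, Complex.conj_I]; ring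

/-- For `r > 0` the point `r v` lies in the open upper half-plane, hence in the slit plane and off
the negative real axis. [folklore] -/
lemma ofReal_mul_rayDir_mem_slitPlane {r : ℝ} (hr : 0 < r) : (r : ℂ) * rayDir ∈ slitPlane := by
  rw [Complex.mem_slitPlane_iff]; right; simp [rayDir, hr.ne']

/-- `arg (r v) ≠ π` for `r > 0`. [folklore] -/
lemma arg_ofReal_mul_rayDir_ne_pi {r : ℝ} (hr : 0 < r) : ((r : ℂ) * rayDir).arg ≠ π := by
  rw [Ne, Complex.arg_eq_pi_iff]; simp [rayDir, hr.ne']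

/-- `‖(rv)^{w}‖ = r^{re w} ‖v^{w}‖` for `r > 0`. [folklore] -/
lemma norm_ofReal_mul_rayDir_cpow {r : ℝ} (hr : 0 < r) (w : ℂ) :
    ‖((r : ℂ) * rayDir) ^ w‖ = r ^ w.re * ‖rayDir ^ w‖ := by
  rw [AFE.ofReal_mul_cpow hr rayDir_ne_zero, norm_mul, Complex.norm_cpow_eq_rpow_re_of_pos hr]

/-- `2πi (rv) = −2πr − 2πir`: real part `−2πr`. [folklore] -/
lemma two_pi_I_mul_rayDir (r : ℝ) :
    2 * π * I * ((r : ℂ) * rayDir) = ((-2 * π * r : ℝ) : ℂ) + ((-2 * π * r : ℝ) : ℂ) * I := by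
  rw [rayDir]; push_cast; ring_nf; rw [I_sq]; ring

/-- `‖e^{2πi(n+1) r v}‖ = e^{−2π(n+1)r}`. [folklore] -/
lemma norm_cexp_two_pi_I_nat_mul_rayDir (n : ℕ) (r : ℝ) :
    ‖cexp (2 * π * I * (n + 1) * ((r : ℂ) * rayDir))‖ = Real.exp (-2 * π * (n + 1) * r) := by
  rw [Complex.norm_exp]
  congr 1
  rw [show 2 * ↑π * I * (↑n + 1) * (↑r * rayDir) = ((n + 1 : ℝ) : ℂ) * (2 * π * I * ((r : ℂ) * rayDir)) by
    push_cast; ring, two_pi_I_mul_rayDir]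
  simp only [mul_re, ofReal_re, ofReal_im, add_re, add_im, mul_im, I_re, I_im, mul_zero, mul_one,
    zero_mul, sub_zero, add_zero, zero_add]
  ring

/-! ## Term C: the Gaussian piece of Riemann's formula and `K(s) = conj 𝓡(1 − s̄)` -/

/-- `K(s) := conj 𝓡(1 − conj s)`, Riemann's second integral `∫_{0↘1} x^{s−1}e^{−πix²}/(e^{πix}−e^{−πix}) dx`
written through `𝓡` by complex conjugation (on the critical line `1 − s̄ = s`, so `K = conj 𝓡`).
[cite: Siegel1932, §3 eq. (56)] -/
def riemannAuxConj (s : ℂ) : ℂ := conj (riemannAux (1 - conj s))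

/-- `conj (F_{s'}(conj y)) = −y^{s−1} e^{−πiy²}/(2i sin(πy))` for `s' = 1 − conj s` and `arg y ≠ π`:
the integrand of `K` is minus the conjugate of Siegel's integrand at the conjugate point.
[folklore] -/
lemma conj_rsKernel_conj (s : ℂ) {y : ℂ} (hy : y.arg ≠ π) :
    conj (rsKernel (1 - conj s) (conj y)) =
      -(y ^ (s - 1) * cexp (-(π * I * y ^ 2)) / (2 * I * Complex.sin (π * y))) := by
  simp only [rsKernel, map_div₀, map_mul]
  have h1 : conj ((conj y) ^ (-(1 - conj s))) = y ^ (s - 1) := by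
    have h := Complex.conj_cpow y (-(1 - conj s)) hy
    rw [h, Complex.conj_conj, map_neg, map_sub, map_one, Complex.conj_conj]
    congr 1; ring
  have h2 : conj (cexp (π * I * (conj y) ^ 2)) = cexp (-(π * I * y ^ 2)) := by
    rw [← Complex.exp_conj]; congr 1
    simp only [map_mul, Complex.conj_ofReal, Complex.conj_I, map_pow, Complex.conj_conj]; ring
  have h3 : conj (Complex.sin (π * conj y)) = Complex.sin (π * y) := by
    rw [← Complex.sin_conj]; congr 1
    simp only [map_mul, Complex.conj_ofReal, Complex.conj_conj]
  rw [h1, h2, h3]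
  simp only [map_ofNat, Complex.conj_I]
  rw [show (2 : ℂ) * -I * Complex.sin (π * y) = -(2 * I * Complex.sin (π * y)) by ring, div_neg]

/-- `conj e^{πi(1 − conj s)} = −e^{πis}`. [folklore] -/
lemma conj_cexp_pi_I_one_sub_conj (s : ℂ) :
    conj (cexp (π * I * (1 - conj s))) = -cexp (π * I * s) := by
  rw [← Complex.exp_conj]
  simp only [map_mul, Complex.conj_ofReal, Complex.conj_I, map_sub, map_one, Complex.conj_conj]
  rw [show (π : ℂ) * -I * (1 - s) = π * I * s + (-(π * I)) by ring, Complex.exp_add, Complex.exp_neg,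
    Complex.exp_pi_mul_I]
  ring

/-- **The integrand of Term C is a conjugate of Siegel's integrand on the ray through the
origin**: for `r > 0` and `s' = 1 − conj s`,
`(rv)^{s−1} e^{−πi(rv)²}/(2i sin(π rv)) · v = −v e^{πis} conj F_{s'}(r(1+i))`. [cite: Siegel1932, §3] -/
lemma rayKernelC_eq {s : ℂ} {r : ℝ} (hr : 0 < r) :
    ((r : ℂ) * rayDir) ^ (s - 1) * cexp (-(π * I * ((r : ℂ) * rayDir) ^ 2)) /
        (2 * I * Complex.sin (π * ((r : ℂ) * rayDir))) * rayDir =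
      -rayDir * cexp (π * I * s) * conj (rsKernel (1 - conj s) (line 0 r)) := by
  set y : ℂ := (r : ℂ) * rayDir with hy
  have hconj : conj y = -(line 0 r) := by
    rw [hy, map_mul, Complex.conj_ofReal, conj_rayDir]; simp only [line]; push_cast; ring
  have him : 0 < (line 0 r).im := by simpa using hr
  -- `F_{s'}(conj y) = F_{s'}(-(line 0 r)) = -e^{πis'} F_{s'}(line 0 r)`
  have hneg : rsKernel (1 - conj s) (conj y) = -cexp (π * I * (1 - conj s)) * rsKernel (1 - conj s) (line 0 r) := by
    rw [hconj, rsKernel_neg him]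
  have hk : conj (rsKernel (1 - conj s) (conj y)) =
      -(y ^ (s - 1) * cexp (-(π * I * y ^ 2)) / (2 * I * Complex.sin (π * y))) :=
    conj_rsKernel_conj s (arg_ofReal_mul_rayDir_ne_pi hr)
  -- so the integrand `k(y) = -conj F(conj y)`
  have hk' : y ^ (s - 1) * cexp (-(π * I * y ^ 2)) / (2 * I * Complex.sin (π * y)) =
      -conj (rsKernel (1 - conj s) (conj y)) := by rw [hk, neg_neg]
  rw [hk', hneg, map_mul, map_neg, conj_cexp_pi_I_one_sub_conj]
  ring

/-- **`K(s)` through the ray integral of Siegel's integrand** (`σ > 2`): with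
`I₊ = ∫_0^∞ F_{s'}(r(1+i)) dr`, `s' = 1 − s̄`, one has `K(s) = −(1 − i)(1 + e^{πis}) conj I₊`
(push the line of `𝓡(s')` onto the origin and split it into two rays). [cite: Siegel1932, §3] -/
theorem riemannAuxConj_eq {s : ℂ} (hs : 2 < s.re) :
    riemannAuxConj s = -(1 - I) * (1 + cexp (π * I * s)) *
      conj (∫ r in Ioi (0 : ℝ), rsKernel (1 - conj s) (line 0 r)) := by
  have hs' : (1 - conj s).re < -1 := by simp; linarith
  rw [riemannAuxConj, riemannAux, rsLineIntegral_eq_zero_line hs' (by norm_num) (by norm_num),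
    rsLineIntegral, integral_rsKernel_line_zero hs']
  simp only [map_mul, map_neg, map_add, map_sub, map_one, Complex.conj_I, conj_cexp_pi_I_one_sub_conj]
  ring

/-- Integrability of the Term-C integrand on the ray (`σ > 2`). [folklore] -/
theorem integrableOn_rayKernelC {s : ℂ} (hs : 2 < s.re) :
    IntegrableOn (fun r : ℝ ↦ ((r : ℂ) * rayDir) ^ (s - 1) * cexp (-(π * I * ((r : ℂ) * rayDir) ^ 2)) /
        (2 * I * Complex.sin (π * ((r : ℂ) * rayDir))) * rayDir) (Ioi 0) := by
  have hs' : (1 - conj s).re < -1 := by simp; linarith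
  have h : Integrable (fun r : ℝ ↦ rsKernel (1 - conj s) (line 0 r)) (volume.restrict (Ioi 0)) :=
    (integrable_rsKernel_line_zero hs').integrableOn
  have h1 : Integrable (fun r : ℝ ↦ conj (rsKernel (1 - conj s) (line 0 r))) (volume.restrict (Ioi 0)) := by
    have := (Complex.conjLIE.integrable_comp_iff (μ := volume.restrict (Ioi 0))
      (φ := fun r : ℝ ↦ rsKernel (1 - conj s) (line 0 r))).2 h
    simpa using this
  have h2 : IntegrableOn (fun r : ℝ ↦ -rayDir * cexp (π * I * s) *
      conj (rsKernel (1 - conj s) (line 0 r))) (Ioi 0) := h1.const_mul _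
  refine h2.congr_fun (fun r hr ↦ ?_) measurableSet_Ioi
  exact (rayKernelC_eq (s := s) hr).symm

/-- **Term C**: `∫_0^∞ (rv)^{s−1} e^{−πi(rv)²}/(2i sin(π rv)) v dr = −v e^{πis} conj I₊` (`σ > 2`).
[cite: Siegel1932, §3] -/
theorem integral_rayKernelC (s : ℂ) :
    ∫ r in Ioi (0 : ℝ), ((r : ℂ) * rayDir) ^ (s - 1) * cexp (-(π * I * ((r : ℂ) * rayDir) ^ 2)) /
        (2 * I * Complex.sin (π * ((r : ℂ) * rayDir))) * rayDir =
      -rayDir * cexp (π * I * s) * conj (∫ r in Ioi (0 : ℝ), rsKernel (1 - conj s) (line 0 r)) := by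
  rw [← integral_conj, ← MeasureTheory.integral_const_mul]
  refine setIntegral_congr_fun measurableSet_Ioi fun r hr ↦ ?_
  exact rayKernelC_eq (s := s) hr


/-! ## Term B: the geometric piece of Riemann's formula yields `ζ(s)` -/

/-- The constant `Q(s) = v^s (1+i)^{−s} (2π)^{−s} Γ(s)` multiplying both `𝓡(s)` (Term A) and
`ζ(s)` (Term B). [folklore] -/
def rsQ (s : ℂ) : ℂ := rayDir ^ s * (1 + I) ^ (-s) * (2 * π) ^ (-s) * Complex.Gamma s

/-- `‖e^{2πi r v}‖ = e^{−2πr} < 1` for `r > 0`. [folklore] -/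
lemma norm_cexp_two_pi_I_rayDir_lt_one {r : ℝ} (hr : 0 < r) :
    ‖cexp (2 * π * I * ((r : ℂ) * rayDir))‖ < 1 := by
  rw [Complex.norm_exp, two_pi_I_mul_rayDir]
  simp only [add_re, ofReal_re, mul_re, ofReal_im, I_re, I_im, mul_zero, mul_one, sub_self, add_zero]
  rw [Real.exp_lt_one_iff]
  nlinarith [Real.pi_pos]

/-- **Geometric expansion** (`r > 0`): `1/(1 − e^{−2πi rv}) = −Σ_{n≥0} e^{2πi(n+1) rv}`
(`|e^{−2πi rv}| = e^{2πr} > 1`). [cite: Siegel1932, §3] -/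
lemma one_div_one_sub_cexp_eq_tsum {r : ℝ} (hr : 0 < r) :
    1 / (1 - cexp (-(2 * π * I * ((r : ℂ) * rayDir)))) =
      -∑' n : ℕ, cexp (2 * π * I * (n + 1) * ((r : ℂ) * rayDir)) := by
  set q : ℂ := cexp (2 * π * I * ((r : ℂ) * rayDir)) with hq
  have hqn : ‖q‖ < 1 := norm_cexp_two_pi_I_rayDir_lt_one hr
  have hq0 : q ≠ 0 := Complex.exp_ne_zero _
  have hq1 : 1 - q ≠ 0 := fun h ↦ by
    have : q = 1 := by linear_combination -h
    rw [this, norm_one] at hqn; exact lt_irrefl _ hqn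
  have hterm : ∀ n : ℕ, cexp (2 * π * I * (n + 1) * ((r : ℂ) * rayDir)) = q * q ^ n := by
    intro n
    rw [← pow_succ', hq, ← Complex.exp_nat_mul]; congr 1; push_cast; ring
  simp_rw [hterm]
  rw [tsum_mul_left, tsum_geometric_of_norm_lt_one hqn, Complex.exp_neg, ← hq]
  have hq1' : q - 1 ≠ 0 := fun h ↦ hq1 (by linear_combination -h)
  have e1 : 1 - q⁻¹ = (q - 1) / q := by field_simp
  rw [e1, one_div_div, ← neg_sub q 1, inv_neg, mul_neg, neg_neg, div_eq_mul_inv]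

/-- The `n`-th term `−v (rv)^{s−1} e^{2πi(n+1) rv}` integrates to
`−v · v^{s−1} (2π)^{−s} (1+i)^{−s} Γ(s) · (n+1)^{−s}` over `r ∈ (0, ∞)` (`σ > 0`): a rotated
Gamma integral with rate `2π(n+1)(1+i)`. [cite: Siegel1932, §3] -/
lemma integral_rayTermB {s : ℂ} (hs : 0 < s.re) (n : ℕ) :
    ∫ r in Ioi (0 : ℝ), -rayDir * (((r : ℂ) * rayDir) ^ (s - 1) *
        cexp (2 * π * I * (n + 1) * ((r : ℂ) * rayDir))) =
      (-rayDir * rayDir ^ (s - 1) * ((2 * π) ^ (-s) * (1 + I) ^ (-s) * Complex.Gamma s)) *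
        (1 / ((n : ℂ) + 1) ^ s) := by
  have hπ := Real.pi_pos
  set μ : ℂ := ((2 * π * (n + 1) : ℝ) : ℂ) * (1 + I) with hμ
  have hμre : 0 < μ.re := by
    rw [hμ]; simp only [mul_re, ofReal_re, ofReal_im, add_re, one_re, I_re, add_im, one_im, I_im,
      zero_mul, sub_zero, add_zero, mul_one]; positivity
  have hμarg : μ.arg ≠ π := by
    rw [Ne, Complex.arg_eq_pi_iff]; intro h; linarith [h.1, hμre]
  have hpt : ∀ r ∈ Ioi (0 : ℝ), -rayDir * (((r : ℂ) * rayDir) ^ (s - 1) *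
      cexp (2 * π * I * (n + 1) * ((r : ℂ) * rayDir))) =
      (-rayDir * rayDir ^ (s - 1)) * ((r : ℂ) ^ (s - 1) * cexp (-(μ * r))) := by
    intro r hr
    rw [AFE.ofReal_mul_cpow hr rayDir_ne_zero]
    have : 2 * π * I * (n + 1) * ((r : ℂ) * rayDir) = -(μ * r) := by
      rw [hμ, rayDir]; push_cast; ring_nf; rw [I_sq]; ring
    rw [this]; ring
  rw [setIntegral_congr_fun measurableSet_Ioi hpt, MeasureTheory.integral_const_mul,
    AFE.integral_cpow_mul_exp_neg_mul_Ioi_complex hs hμre]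
  -- `(1/μ)^s = (2π)^{-s} (1+i)^{-s} (n+1)^{-s}`
  have h1 : (1 / μ) ^ s = (2 * π) ^ (-s) * (1 + I) ^ (-s) * (1 / ((n : ℂ) + 1) ^ s) := by
    rw [one_div, Complex.inv_cpow _ _ hμarg, hμ,
      AFE.ofReal_mul_cpow (by positivity) Literature.Analysis.Complex.one_add_I_ne_zero]
    rw [show ((2 * π * (n + 1) : ℝ) : ℂ) = ((2 * π : ℝ) : ℂ) * ((n + 1 : ℝ) : ℂ) by push_cast; ring,
      Complex.mul_cpow_ofReal_nonneg (by positivity) (by positivity)]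
    rw [Complex.cpow_neg, Complex.cpow_neg]
    push_cast
    field_simp
  rw [h1]
  ring

/-- Norm of the `n`-th term: `∫_0^∞ ‖−v (rv)^{s−1} e^{2πi(n+1)rv}‖ dr = √2 ‖v^{s−1}‖ (2π(n+1))^{−σ} Γ(σ)`.
[folklore] -/
lemma integral_norm_rayTermB {s : ℂ} (hs : 0 < s.re) (n : ℕ) :
    ∫ r in Ioi (0 : ℝ), ‖-rayDir * (((r : ℂ) * rayDir) ^ (s - 1) *
        cexp (2 * π * I * (n + 1) * ((r : ℂ) * rayDir)))‖ =
      ‖rayDir‖ * ‖rayDir ^ (s - 1)‖ * ((1 / (2 * π * (n + 1))) ^ s.re * Real.Gamma s.re) := by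
  have hpt : ∀ r ∈ Ioi (0 : ℝ), ‖-rayDir * (((r : ℂ) * rayDir) ^ (s - 1) *
      cexp (2 * π * I * (n + 1) * ((r : ℂ) * rayDir)))‖ =
      ‖rayDir‖ * ‖rayDir ^ (s - 1)‖ * (r ^ (s.re - 1) * Real.exp (-(2 * π * (n + 1) * r))) := by
    intro r hr
    rw [norm_mul, norm_neg, norm_mul, norm_ofReal_mul_rayDir_cpow hr, norm_cexp_two_pi_I_nat_mul_rayDir,
      sub_re, one_re]
    ring_nf
  rw [setIntegral_congr_fun measurableSet_Ioi hpt, MeasureTheory.integral_const_mul,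
    Real.integral_rpow_mul_exp_neg_mul_Ioi hs (by positivity)]

/-- Integrability of the `n`-th term on the ray. [folklore] -/
lemma integrableOn_rayTermB {s : ℂ} (hs : 0 < s.re) (n : ℕ) :
    IntegrableOn (fun r : ℝ ↦ -rayDir * (((r : ℂ) * rayDir) ^ (s - 1) *
        cexp (2 * π * I * (n + 1) * ((r : ℂ) * rayDir)))) (Ioi 0) := by
  have hcont : ContinuousOn (fun r : ℝ ↦ -rayDir * (((r : ℂ) * rayDir) ^ (s - 1) *
      cexp (2 * π * I * (n + 1) * ((r : ℂ) * rayDir)))) (Ioi 0) := by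
    refine continuousOn_const.mul (ContinuousOn.mul ?_ (by fun_prop))
    exact ContinuousOn.cpow (by fun_prop) continuousOn_const
      fun r hr ↦ ofReal_mul_rayDir_mem_slitPlane hr
  have hg : IntegrableOn (fun r : ℝ ↦ ‖rayDir‖ * ‖rayDir ^ (s - 1)‖ *
      (Real.exp (-(2 * π * (n + 1) * r)) * r ^ (s.re - 1))) (Ioi 0) :=
    (AFE.integrableOn_exp_neg_mul_mul_rpow (by positivity) (by linarith)).const_mul _
  refine Integrable.mono' hg (hcont.aestronglyMeasurable measurableSet_Ioi) ?_
  refine (ae_restrict_iff' measurableSet_Ioi).2 (Eventually.of_forall fun r hr ↦ ?_)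
  rw [norm_mul, norm_neg, norm_mul, norm_ofReal_mul_rayDir_cpow hr, norm_cexp_two_pi_I_nat_mul_rayDir,
    sub_re, one_re]
  apply le_of_eq; ring_nf

/-- **Term B** (`σ > 1`): `∫_0^∞ (rv)^{s−1}/(1 − e^{−2πi rv}) v dr = −Q(s) ζ(s)`: the geometric series
is integrated term by term (`integral_tsum_of_summable_integral_norm`, the norms summing to
`√2‖v^{s−1}‖Γ(σ)(2π)^{−σ} ζ(σ)`), each term being a Gamma integral, and `Σ (n+1)^{−s} = ζ(s)`.
[cite: Siegel1932, §3] -/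
theorem integral_rayKernelB {s : ℂ} (hs : 1 < s.re) :
    ∫ r in Ioi (0 : ℝ), ((r : ℂ) * rayDir) ^ (s - 1) /
        (1 - cexp (-(2 * π * I * ((r : ℂ) * rayDir)))) * rayDir = -rsQ s * riemannZeta s := by
  have hs0 : 0 < s.re := by linarith
  -- pointwise expansion
  have hpt : ∀ r ∈ Ioi (0 : ℝ), ((r : ℂ) * rayDir) ^ (s - 1) /
      (1 - cexp (-(2 * π * I * ((r : ℂ) * rayDir)))) * rayDir =
      ∑' n : ℕ, -rayDir * (((r : ℂ) * rayDir) ^ (s - 1) *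
        cexp (2 * π * I * (n + 1) * ((r : ℂ) * rayDir))) := by
    intro r hr
    rw [div_eq_mul_one_div, one_div_one_sub_cexp_eq_tsum hr]
    have : (fun n : ℕ ↦ -rayDir * (((r : ℂ) * rayDir) ^ (s - 1) *
        cexp (2 * π * I * (n + 1) * ((r : ℂ) * rayDir)))) =
        fun n : ℕ ↦ (-rayDir * ((r : ℂ) * rayDir) ^ (s - 1)) *
          cexp (2 * π * I * (n + 1) * ((r : ℂ) * rayDir)) := by
      funext n; ring
    rw [this, tsum_mul_left, mul_neg, ← neg_mul]
    ring
  -- summability of the norms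
  have hsum : Summable fun n : ℕ ↦ ∫ r in Ioi (0 : ℝ), ‖-rayDir * (((r : ℂ) * rayDir) ^ (s - 1) *
      cexp (2 * π * I * (n + 1) * ((r : ℂ) * rayDir)))‖ := by
    have hterm : ∀ n : ℕ, ∫ r in Ioi (0 : ℝ), ‖-rayDir * (((r : ℂ) * rayDir) ^ (s - 1) *
        cexp (2 * π * I * (n + 1) * ((r : ℂ) * rayDir)))‖ =
        (‖rayDir‖ * ‖rayDir ^ (s - 1)‖ * Real.Gamma s.re * (2 * π) ^ (-s.re)) *
          ((n : ℝ) + 1) ^ (-s.re) := by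
      intro n
      rw [integral_norm_rayTermB hs0 n]
      have h2 : (1 / (2 * π * ((n : ℝ) + 1))) ^ s.re = (2 * π) ^ (-s.re) * ((n : ℝ) + 1) ^ (-s.re) := by
        rw [one_div, Real.inv_rpow (by positivity), ← Real.rpow_neg (by positivity),
          Real.mul_rpow (by positivity) (by positivity)]
      rw [h2]; ring
    simp_rw [hterm]
    refine Summable.mul_left _ ?_
    have h := (summable_nat_add_iff (f := fun n : ℕ ↦ (n : ℝ) ^ (-s.re)) 1).2
      (Real.summable_nat_rpow.2 (by linarith))
    refine h.congr fun n ↦ ?_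
    push_cast; ring_nf
  -- term-by-term integration
  rw [setIntegral_congr_fun measurableSet_Ioi hpt,
    ← integral_tsum_of_summable_integral_norm (fun n ↦ integrableOn_rayTermB hs0 n) hsum]
  simp_rw [integral_rayTermB hs0]
  rw [tsum_mul_left, ← zeta_eq_tsum_one_div_nat_add_one_cpow hs, rsQ]
  have hv : rayDir * rayDir ^ (s - 1) = rayDir ^ s := by
    rw [Complex.cpow_sub _ _ rayDir_ne_zero, Complex.cpow_one]
    field_simp [rayDir_ne_zero]
  calc -rayDir * rayDir ^ (s - 1) * ((2 * ↑π) ^ (-s) * (1 + I) ^ (-s) * Complex.Gamma s) * riemannZeta s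
      = -(rayDir * rayDir ^ (s - 1)) * ((1 + I) ^ (-s) * (2 * ↑π) ^ (-s) * Complex.Gamma s) * riemannZeta s := by ring
    _ = -(rayDir ^ s * (1 + I) ^ (-s) * (2 * ↑π) ^ (-s) * Complex.Gamma s) * riemannZeta s := by
        rw [hv]; ring


/-! ## Term A: Fubini, and the inner Gamma integral -/

/-- `((1+i) x)^w = (1+i)^w x^w` for `x` on the line through `½` (no winding: `arg(1+i) ∈ [0, π/2)`
and `arg x ∈ (−π, π/2]`). [folklore] -/
lemma one_add_I_mul_line_cpow (u : ℝ) (w : ℂ) :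
    ((1 + I) * line (1 / 2) u) ^ w = (1 + I) ^ w * (line (1 / 2) u) ^ w := by
  have hx0 : line (1 / 2) u ≠ 0 := line_ne_zero (by norm_num) u
  have he0 := Literature.Analysis.Complex.one_add_I_ne_zero
  have harg : (1 + I : ℂ).arg + (line (1 / 2) u).arg ∈ Set.Ioc (-π) π := by
    have hπ := Real.pi_pos
    have h1 : 0 ≤ (1 + I : ℂ).arg := Complex.arg_nonneg_iff.2 (by simp)
    have h2 : (1 + I : ℂ).arg < π / 2 := by
      have := (Complex.abs_arg_lt_pi_div_two_iff (z := 1 + I)).2 (Or.inl (by simp))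
      exact (abs_lt.1 this).2
    have h3 : -π < (line (1 / 2) u).arg := Complex.neg_pi_lt_arg _
    have h4 : (line (1 / 2) u).arg ≤ π / 2 := by
      rcases le_or_gt 0 u with hu | hu
      · have hre : 0 < (line (1 / 2) u).re := by rw [line_re]; linarith
        have := (Complex.abs_arg_lt_pi_div_two_iff (z := line (1 / 2) u)).2 (Or.inl hre)
        exact (abs_lt.1 this).2.le
      · have : (line (1 / 2) u).arg < 0 := Complex.arg_neg_iff.2 (by rw [line_im]; exact hu)
        linarith
    exact ⟨by linarith, by linarith⟩
  rw [cpow_def_of_ne_zero (mul_ne_zero he0 hx0), cpow_def_of_ne_zero he0, cpow_def_of_ne_zero hx0,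
    ← Complex.exp_add, (Complex.log_mul_eq_add_log_iff he0 hx0).2 harg]
  ring_nf

/-- **The inner integral of Term A** (`σ > 0`): for `x = ½ + u(1+i)`,
`∫_0^∞ (rv)^{s−1} e^{πix² + 2πi(rv)x}/(2i sin πx) dr = v^{s−1}Γ(s)(2π)^{−s}(1+i)^{−s} · F_s(x)`
(a Gamma integral with rate `λ = 2π(1+i)x`, `re λ = π`). [cite: Siegel1932, §3] -/
lemma integral_rayTermA_inner {s : ℂ} (hs : 0 < s.re) (u : ℝ) :
    ∫ r in Ioi (0 : ℝ), ((r : ℂ) * rayDir) ^ (s - 1) * mordellKernel ((r : ℂ) * rayDir) (line (1 / 2) u) =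
      (rayDir ^ (s - 1) * Complex.Gamma s * (2 * π) ^ (-s) * (1 + I) ^ (-s)) * rsKernel s (line (1 / 2) u) := by
  have hπ := Real.pi_pos
  set x : ℂ := line (1 / 2) u with hx
  have hx0 : x ≠ 0 := line_ne_zero (by norm_num) u
  set lam : ℂ := ((2 * π : ℝ) : ℂ) * ((1 + I) * x) with hlam
  have hlamre : lam.re = π := by
    rw [hlam, hx, line_eq]
    simp only [mul_re, ofReal_re, ofReal_im, add_re, one_re, I_re, add_im, one_im, I_im, mul_im,
      zero_mul, sub_zero, add_zero, zero_add]
    ring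
  have hlampos : 0 < lam.re := by rw [hlamre]; exact hπ
  have hlamarg : lam.arg ≠ π := by
    rw [Ne, Complex.arg_eq_pi_iff]; intro h; linarith [h.1]
  -- rewrite the integrand as `P · ((r)^{s-1} v^{s-1} e^{-λ r})`
  have hpt : ∀ r ∈ Ioi (0 : ℝ), ((r : ℂ) * rayDir) ^ (s - 1) * mordellKernel ((r : ℂ) * rayDir) x =
      (rayDir ^ (s - 1) * (cexp (π * I * x ^ 2) / (2 * I * Complex.sin (π * x)))) *
        ((r : ℂ) ^ (s - 1) * cexp (-(lam * r))) := by
    intro r hr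
    rw [AFE.ofReal_mul_cpow hr rayDir_ne_zero, mordellKernel]
    have : π * I * x ^ 2 + 2 * π * I * ((r : ℂ) * rayDir) * x = π * I * x ^ 2 + -(lam * r) := by
      rw [hlam, rayDir]; push_cast; ring_nf; rw [I_sq]; ring
    rw [this, Complex.exp_add]
    ring
  rw [setIntegral_congr_fun measurableSet_Ioi hpt, MeasureTheory.integral_const_mul,
    AFE.integral_cpow_mul_exp_neg_mul_Ioi_complex hs hlampos]
  -- `(1/λ)^s = (2π)^{-s} (1+i)^{-s} x^{-s}`
  have h1 : (1 / lam) ^ s = (2 * π) ^ (-s) * (1 + I) ^ (-s) * x ^ (-s) := by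
    rw [one_div, Complex.inv_cpow _ _ hlamarg, hlam,
      AFE.ofReal_mul_cpow (by positivity) (mul_ne_zero Literature.Analysis.Complex.one_add_I_ne_zero hx0),
      one_add_I_mul_line_cpow u s, Complex.cpow_neg, Complex.cpow_neg, Complex.cpow_neg]
    push_cast
    rw [← hx]
    ring
  rw [h1, rsKernel]
  ring

/-- Modulus of the joint integrand of Term A: for `r > 0`,
`‖(rv)^{s−1} M_{rv}(x_u)‖ = r^{σ−1}‖v^{s−1}‖ e^{−2πu² − πu − πr}/(2‖sin(πx_u)‖)`
(the cross terms `±2πru` cancel — the reason for integrating along the ray `arg w = 3π/4`).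
[folklore] -/
lemma norm_rayTermA {s : ℂ} {r : ℝ} (hr : 0 < r) (u : ℝ) :
    ‖((r : ℂ) * rayDir) ^ (s - 1) * mordellKernel ((r : ℂ) * rayDir) (line (1 / 2) u)‖ =
      r ^ (s.re - 1) * ‖rayDir ^ (s - 1)‖ *
        (Real.exp (-2 * π * u ^ 2 - π * u - π * r) / (2 * ‖Complex.sin (π * line (1 / 2) u)‖)) := by
  rw [norm_mul, norm_ofReal_mul_rayDir_cpow hr, sub_re, one_re, mordellKernel_eq, norm_div, norm_mul,
    norm_cexp_quadPhase, norm_inv, norm_mul, Complex.norm_two, Complex.norm_I, mul_one]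
  have hb : (2 * π * I * ((r : ℂ) * rayDir)).re = -2 * π * r ∧
      (2 * π * I * ((r : ℂ) * rayDir)).im = -2 * π * r := by
    rw [two_pi_I_mul_rayDir]; constructor <;> simp
  rw [hb.1, hb.2]
  have hE : Real.exp (-2 * π * u ^ 2 - 2 * π * (1 / 2) * u + -2 * π * r * (1 / 2 + u) - -2 * π * r * u)
      = Real.exp (-2 * π * u ^ 2 - π * u - π * r) := by
    congr 1; ring
  rw [hE]
  ring

/-- **Integrability of the joint integrand of Term A** on `(0,∞) × ℝ` (`σ > 0`): it is continuous
and dominated by the product `[‖v^{s−1}‖ r^{σ−1} e^{−πr}] · [e^{−2πu² − πu}]` (`‖sin(πx_u)‖ ≥ ½`).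
[folklore] -/
lemma integrable_rayTermA {s : ℂ} (hs : 0 < s.re) :
    Integrable (fun p : ℝ × ℝ ↦ ((p.1 : ℂ) * rayDir) ^ (s - 1) *
        mordellKernel ((p.1 : ℂ) * rayDir) (line (1 / 2) p.2))
      ((volume.restrict (Ioi 0)).prod volume) := by
  have hmeas : AEStronglyMeasurable (fun p : ℝ × ℝ ↦ ((p.1 : ℂ) * rayDir) ^ (s - 1) *
      mordellKernel ((p.1 : ℂ) * rayDir) (line (1 / 2) p.2)) ((volume.restrict (Ioi 0)).prod volume) := by
    rw [Measure.restrict_prod_eq_prod_univ]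
    refine ContinuousOn.aestronglyMeasurable ?_ (measurableSet_Ioi.prod MeasurableSet.univ)
    intro p hp
    have hr : 0 < p.1 := hp.1
    refine ContinuousAt.continuousWithinAt (ContinuousAt.mul ?_ ?_)
    · have hf : ContinuousAt (fun p : ℝ × ℝ ↦ (p.1 : ℂ) * rayDir) p := by fun_prop
      exact ContinuousAt.comp (f := fun p : ℝ × ℝ ↦ (p.1 : ℂ) * rayDir) (g := fun z : ℂ ↦ z ^ (s - 1))
        (continuousAt_cpow_const (ofReal_mul_rayDir_mem_slitPlane hr)) hf
    · simp only [mordellKernel]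
      exact ContinuousAt.div (by fun_prop) (by fun_prop)
        (mul_ne_zero (mul_ne_zero two_ne_zero I_ne_zero) (sin_pi_line_ne_zero int_ne_half p.2))
  have hg₁ : Integrable (fun r : ℝ ↦ ‖rayDir ^ (s - 1)‖ * (Real.exp (-(π * r)) * r ^ (s.re - 1)))
      (volume.restrict (Ioi 0)) :=
    (AFE.integrableOn_exp_neg_mul_mul_rpow Real.pi_pos (by linarith)).const_mul _
  have hg₂ : Integrable (fun u : ℝ ↦ (1 + |u|) ^ 0 * Real.exp (-2 * π * u ^ 2 + (-π) * u + 0)) :=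
    integrable_poly_mul_gaussian 0 (-π) 0
  have hprod := hg₁.mul_prod hg₂
  refine hprod.mono' hmeas ?_
  have hae : ∀ᵐ p : ℝ × ℝ ∂((volume.restrict (Ioi (0 : ℝ))).prod (volume : Measure ℝ)), 0 < p.1 := by
    rw [Measure.restrict_prod_eq_prod_univ]
    exact (ae_restrict_iff' (measurableSet_Ioi.prod MeasurableSet.univ)).2
      (Eventually.of_forall fun p hp ↦ hp.1)
  filter_upwards [hae] with p hp
  rw [norm_rayTermA hp]
  have hsin : (1 : ℝ) / 2 ≤ ‖Complex.sin (π * line (1 / 2) p.2)‖ :=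
    le_norm_sin_pi_line half_le_abs_half_sub_int p.2
  have hsin0 : 0 < ‖Complex.sin (π * line (1 / 2) p.2)‖ := lt_of_lt_of_le (by norm_num) hsin
  have hexp : Real.exp (-2 * π * p.2 ^ 2 - π * p.2 - π * p.1) =
      Real.exp (-(π * p.1)) * Real.exp (-2 * π * p.2 ^ 2 + (-π) * p.2 + 0) := by
    rw [← Real.exp_add]; congr 1; ring
  rw [hexp, pow_zero, one_mul]
  rw [show p.1 ^ (s.re - 1) * ‖rayDir ^ (s - 1)‖ *
      (Real.exp (-(π * p.1)) * Real.exp (-2 * π * p.2 ^ 2 + -π * p.2 + 0) /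
        (2 * ‖Complex.sin (↑π * line (1 / 2) p.2)‖))
      = ‖rayDir ^ (s - 1)‖ * (Real.exp (-(π * p.1)) * p.1 ^ (s.re - 1)) *
          Real.exp (-2 * π * p.2 ^ 2 + -π * p.2 + 0) * (1 / (2 * ‖Complex.sin (↑π * line (1 / 2) p.2)‖)) by
    field_simp]
  have h1 : 1 / (2 * ‖Complex.sin (↑π * line (1 / 2) p.2)‖) ≤ 1 := by
    rw [div_le_one (by positivity)]; linarith
  have h0 : 0 ≤ ‖rayDir ^ (s - 1)‖ * (Real.exp (-(π * p.1)) * p.1 ^ (s.re - 1)) *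
      Real.exp (-2 * π * p.2 ^ 2 + -π * p.2 + 0) := by
    have : 0 ≤ p.1 ^ (s.re - 1) := Real.rpow_nonneg hp.le _
    positivity
  exact (mul_le_of_le_one_right h0 h1)

/-- **Term A** (`σ > 0`): `∫_0^∞ (rv)^{s−1} Ψ(rv) v dr = −Q(s) 𝓡(s)` — the `w`-integral of Riemann's
integral is the double integral of `(rv)^{s−1}e^{πix²+2πi(rv)x}/(2i sin πx)`; by Fubini the
`r`-integration is done first and gives `v^{s−1}Γ(s)(2π)^{−s}(1+i)^{−s} F_s(x)`, whose `x`-integral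
over the line through `½` is `−𝓡(s)/(1+i)`. [cite: Siegel1932, §3 eq. (55)] -/
theorem integral_rayKernelA {s : ℂ} (hs : 0 < s.re) :
    ∫ r in Ioi (0 : ℝ), ((r : ℂ) * rayDir) ^ (s - 1) * mordellPsi (1 / 2) ((r : ℂ) * rayDir) * rayDir =
      -rsQ s * riemannAux s := by
  have h1 : ∀ r : ℝ, ((r : ℂ) * rayDir) ^ (s - 1) * mordellPsi (1 / 2) ((r : ℂ) * rayDir) * rayDir =
      ((1 + I) * rayDir) * ∫ u : ℝ, ((r : ℂ) * rayDir) ^ (s - 1) *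
        mordellKernel ((r : ℂ) * rayDir) (line (1 / 2) u) := by
    intro r
    rw [mordellPsi, MeasureTheory.integral_const_mul]
    ring
  simp_rw [h1]
  rw [MeasureTheory.integral_const_mul]
  have hint : Integrable (Function.uncurry fun (r u : ℝ) ↦ ((r : ℂ) * rayDir) ^ (s - 1) *
      mordellKernel ((r : ℂ) * rayDir) (line (1 / 2) u)) ((volume.restrict (Ioi 0)).prod volume) :=
    integrable_rayTermA hs
  have hswap := MeasureTheory.integral_integral_swap hint
  rw [hswap]
  simp_rw [integral_rayTermA_inner hs]
  rw [MeasureTheory.integral_const_mul]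
  have hR : ∫ u : ℝ, rsKernel s (line (1 / 2) u) = -riemannAux s / (1 + I) := by
    rw [riemannAux_def]
    field_simp [Literature.Analysis.Complex.one_add_I_ne_zero]
  rw [hR, rsQ]
  have hv : rayDir * rayDir ^ (s - 1) = rayDir ^ s := by
    rw [Complex.cpow_sub _ _ rayDir_ne_zero, Complex.cpow_one]
    field_simp [rayDir_ne_zero]
  have he0 := Literature.Analysis.Complex.one_add_I_ne_zero
  rw [← hv]
  field_simp


/-! ## Assembly on `2 < σ < 3` -/

/-- `χ(s) = (2π)^s/(2Γ(s)cos(πs/2))` — Titchmarsh's factor of the functional equation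
`ζ(s) = χ(s)ζ(1−s)`, in the closed form obtained from (2.1.8) `ζ(1−s) = 2^{1−s}π^{−s}cos(πs/2)Γ(s)ζ(s)`
read with (2.1.9); it appears literally in Siegel 1932, §2 eq. (32). Relation to the tree's two
versions of this factor: (i) `rsChi s = (Literature.NumberTheory.LFunctions.ZetaM4.feFactor s)⁻¹`
for EVERY `s` (`Literature.NumberTheory.LFunctions.SiegelIntegral.rsChi_eq_inv_feFactor`;
`feFactor s = 2(2π)^{−s}Γ(s)cos(πs/2)`, `ZetaSqReflectionPrinciple.lean`, whose unimodularity on the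
critical line is `Literature.NumberTheory.LFunctions.BaezDuarteU.norm_feFactor_half`); (ii) `rsChi s =
Literature.NumberTheory.LFunctions.riemannZetaChi s` (`= 2^s π^{s−1} sin(πs/2) Γ(1−s)`, (2.1.10),
`ZetaSubconvexity.lean`) whenever `sin(πs) ≠ 0`
(`Literature.NumberTheory.LFunctions.SiegelIntegral.rsChi_eq_riemannZetaChi`); the closed form is
used here rather than `riemannZetaChi` because the latter takes Mathlib's junk value `Γ(−1) = 0`
at `s = 2` (`riemannZetaChi 2 = 0`), whereas the integral formula below is first proved on the strip
`2 < σ < 3` and needs the true `χ(2) = −2π²` there. [cite: Titchmarsh1986, §2.1 eqs. (2.1.8)–(2.1.9)] -/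
def rsChi (s : ℂ) : ℂ := (2 * π) ^ s / (2 * Complex.Gamma s * Complex.cos (π * s / 2))

/-- Unfolding `rsChi`. [folklore] -/
lemma rsChi_def (s : ℂ) : rsChi s = (2 * π) ^ s / (2 * Complex.Gamma s * Complex.cos (π * s / 2)) := rfl

/-- **Bridge to `ZetaM4.feFactor`**: `rsChi s = (feFactor s)⁻¹` for every `s` (also at the junk
points, where both sides vanish). [cite: Titchmarsh1986, §2.1 eqs. (2.1.8)–(2.1.9)] -/
theorem rsChi_eq_inv_feFactor (s : ℂ) : rsChi s = (ZetaM4.feFactor s)⁻¹ := by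
  rw [rsChi, ZetaM4.feFactor, Complex.cpow_neg]
  simp only [mul_inv, inv_inv, div_eq_mul_inv]
  ring

/-- **Bridge to the tree's `riemannZetaChi`**: for `sin(πs) ≠ 0` (i.e. `s ∉ ℤ`),
`rsChi s = riemannZetaChi s` — by the reflection formula `Γ(s)Γ(1−s) = π/sin(πs)`,
`sin(πs) = 2 sin(πs/2)cos(πs/2)` and `(2π)^s = 2^s π^s`. [cite: Titchmarsh1986, §2.1 eqs. (2.1.8)–(2.1.9)] -/
theorem rsChi_eq_riemannZetaChi {s : ℂ} (hs : Complex.sin (π * s) ≠ 0) :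
    rsChi s = riemannZetaChi s := by
  have hπne : (π : ℂ) ≠ 0 := ofReal_ne_zero.2 Real.pi_ne_zero
  have hΓ : Complex.Gamma s * Complex.Gamma (1 - s) = π / Complex.sin (π * s) :=
    Complex.Gamma_mul_Gamma_one_sub s
  have hdouble : Complex.sin (π * s) = 2 * Complex.sin (π * s / 2) * Complex.cos (π * s / 2) := by
    rw [show (π : ℂ) * s = 2 * (π * s / 2) by ring, Complex.sin_two_mul]
    ring
  have hcos : Complex.cos (π * s / 2) ≠ 0 := fun h0 ↦ hs (by rw [hdouble, h0, mul_zero])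
  have hΓs : Complex.Gamma s ≠ 0 := by
    intro h0
    rw [h0, zero_mul] at hΓ
    exact div_ne_zero hπne hs hΓ.symm
  have hsin2 : Complex.sin (π * s / 2) ≠ 0 := fun h0 ↦ hs (by rw [hdouble, h0, mul_zero, zero_mul])
  have hΓ1 : Complex.Gamma (1 - s) = π / (Complex.sin (π * s) * Complex.Gamma s) := by
    rw [eq_div_iff (mul_ne_zero hs hΓs)]
    calc Complex.Gamma (1 - s) * (Complex.sin (π * s) * Complex.Gamma s)
        = (Complex.Gamma s * Complex.Gamma (1 - s)) * Complex.sin (π * s) := by ring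
      _ = π / Complex.sin (π * s) * Complex.sin (π * s) := by rw [hΓ]
      _ = π := div_mul_cancel₀ _ hs
  have h2π : (2 * (π : ℂ)) ^ s = 2 ^ s * (π : ℂ) ^ s :=
    Complex.mul_cpow_ofReal_nonneg (by norm_num) Real.pi_pos.le _
  have hπs : (π : ℂ) ^ s = (π : ℂ) ^ (s - 1) * π := by
    rw [Complex.cpow_sub _ _ hπne, Complex.cpow_one]
    field_simp
  have hcos' : Complex.cos (s * π / 2) ≠ 0 := by rw [mul_comm s (π : ℂ)]; exact hcos
  have hsin2' : Complex.sin (s * π / 2) ≠ 0 := by rw [mul_comm s (π : ℂ)]; exact hsin2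
  rw [rsChi, riemannZetaChi, hΓ1, h2π, hπs, hdouble]
  field_simp

/-- `v^s (1+i)^{−s} = e^{πis/2}` (`v = i(1+i)`, `log v − log(1+i) = log i = πi/2`). [folklore] -/
lemma rayDir_cpow_mul_one_add_I_cpow_neg (s : ℂ) :
    rayDir ^ s * (1 + I) ^ (-s) = cexp (π * I * s / 2) := by
  have he0 := Literature.Analysis.Complex.one_add_I_ne_zero
  have harg : I.arg + (1 + I : ℂ).arg ∈ Set.Ioc (-π) π := by
    have hπ := Real.pi_pos
    rw [Complex.arg_I]
    have h1 : 0 ≤ (1 + I : ℂ).arg := Complex.arg_nonneg_iff.2 (by simp)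
    have h2 : (1 + I : ℂ).arg < π / 2 := by
      have := (Complex.abs_arg_lt_pi_div_two_iff (z := 1 + I)).2 (Or.inl (by simp))
      exact (abs_lt.1 this).2
    exact ⟨by linarith, by linarith⟩
  rw [cpow_def_of_ne_zero rayDir_ne_zero, cpow_def_of_ne_zero he0, ← Complex.exp_add, rayDir_eq_I_mul,
    (Complex.log_mul_eq_add_log_iff I_ne_zero he0).2 harg, Complex.log_I]
  congr 1
  ring

/-- `Q(s)(e^{πis} + 1) = 2(2π)^{−s}Γ(s)cos(πs/2) e^{πis}`. [folklore] -/
lemma rsQ_mul_cexp_add_one (s : ℂ) :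
    rsQ s * (cexp (π * I * s) + 1) =
      2 * (2 * π) ^ (-s) * Complex.Gamma s * Complex.cos (π * s / 2) * cexp (π * I * s) := by
  rw [rsQ, show rayDir ^ s * (1 + I) ^ (-s) * (2 * ↑π) ^ (-s) * Complex.Gamma s
      = (rayDir ^ s * (1 + I) ^ (-s)) * ((2 * ↑π) ^ (-s) * Complex.Gamma s) by ring,
    rayDir_cpow_mul_one_add_I_cpow_neg,
    show (2 : ℂ) * (2 * ↑π) ^ (-s) * Complex.Gamma s * Complex.cos (↑π * s / 2) * cexp (↑π * I * s)
      = (2 * ↑π) ^ (-s) * Complex.Gamma s * (2 * Complex.cos (↑π * s / 2)) * cexp (↑π * I * s) by ring,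
    Complex.two_cos]
  have e1 : cexp (π * I * s / 2) * cexp (π * I * s / 2) = cexp (π * I * s) := by
    rw [← Complex.exp_add]; congr 1; ring
  have e2 : cexp (π * s / 2 * I) = cexp (π * I * s / 2) := by congr 1; ring
  have e3 : cexp (-(π * s / 2) * I) * cexp (π * I * s / 2) = 1 := by
    rw [← Complex.exp_add, show -(↑π * s / 2) * I + ↑π * I * s / 2 = 0 by ring, Complex.exp_zero]
  rw [e2]
  linear_combination ((2 * ↑π) ^ (-s) * Complex.Gamma s * cexp (-(↑π * s / 2) * I)) * e1 -
    ((2 * ↑π) ^ (-s) * Complex.Gamma s * cexp (↑π * I * s / 2)) * e3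

/-- For `2 < σ < 3`, `s` is not an odd integer, so `1 + e^{πis} ≠ 0`. [folklore] -/
lemma one_add_cexp_ne_zero {s : ℂ} (hs2 : 2 < s.re) (hs3 : s.re < 3) : 1 + cexp (π * I * s) ≠ 0 := by
  intro h
  have h1 : cexp (π * I * s) = cexp (π * I) := by rw [Complex.exp_pi_mul_I]; linear_combination h
  obtain ⟨n, hn⟩ := Complex.exp_eq_exp_iff_exists_int.1 h1
  have h3 := congrArg Complex.im hn
  simp only [mul_im, mul_re, ofReal_re, ofReal_im, I_re, I_im, mul_zero, mul_one, sub_zero, zero_add,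
    add_im, intCast_re, intCast_im, re_ofNat, im_ofNat, zero_mul, add_zero, sub_self] at h3
  -- h3 : π * s.re = π + n * (2 * π)
  have h4 : s.re = 1 + 2 * n := by
    have hπ := Real.pi_ne_zero
    field_simp at h3
    nlinarith [Real.pi_pos, h3]
  have h5 : (1 : ℝ) / 2 < n := by linarith
  have h6 : (n : ℝ) < 1 := by linarith
  have h7 : (0 : ℤ) < n := by exact_mod_cast (by linarith : (0 : ℝ) < n)
  have h8 : n < 1 := by exact_mod_cast h6
  omega

/-- For `0 < σ < 3`, `s ≠ 1`: `cos(πs/2) ≠ 0`. [folklore] -/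
lemma cos_ne_zero_of_re {s : ℂ} (hs0 : 0 < s.re) (hs3 : s.re < 3) (hs1 : s ≠ 1) :
    Complex.cos (π * s / 2) ≠ 0 := by
  intro h
  obtain ⟨k, hk⟩ := Complex.cos_eq_zero_iff.1 h
  have hπ : (π : ℂ) ≠ 0 := ofReal_ne_zero.2 Real.pi_ne_zero
  have hs : s = 2 * k + 1 := by
    have h2 : (π : ℂ) * s = π * (2 * k + 1) := by linear_combination 2 * hk
    exact mul_left_cancel₀ hπ h2
  have hre : s.re = 2 * k + 1 := by rw [hs]; simp
  have him : s.im = 0 := by rw [hs]; simp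
  have hk0 : (-1 : ℝ) < k := by linarith
  have hk1 : (k : ℝ) < 1 := by linarith
  have hk0' : (-1 : ℤ) < k := by exact_mod_cast hk0
  have hk1' : k < 1 := by exact_mod_cast hk1
  have hk00 : k = 0 := by omega
  apply hs1
  apply Complex.ext
  · rw [hre, hk00]; simp
  · rw [him]; simp

/-- `Q(s) ≠ 0` for `σ > 0`. [folklore] -/
lemma rsQ_ne_zero {s : ℂ} (hs : 0 < s.re) : rsQ s ≠ 0 := by
  rw [rsQ]
  have hπ : (2 * π : ℂ) ≠ 0 := by simp [Real.pi_ne_zero]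
  refine mul_ne_zero (mul_ne_zero (mul_ne_zero ?_ ?_) ?_) (Complex.Gamma_ne_zero_of_re_pos hs)
  · exact fun h ↦ rayDir_ne_zero ((Complex.cpow_eq_zero_iff _ _).1 h).1
  · exact fun h ↦ Literature.Analysis.Complex.one_add_I_ne_zero ((Complex.cpow_eq_zero_iff _ _).1 h).1
  · exact fun h ↦ hπ ((Complex.cpow_eq_zero_iff _ _).1 h).1

/-- `χ(s) = e^{πis}/(Q(s)(e^{πis} + 1))` where both sides make sense. [folklore] -/
lemma rsChi_eq {s : ℂ} (hs0 : 0 < s.re) (hs3 : s.re < 3) (hs1 : s ≠ 1) (hE : 1 + cexp (π * I * s) ≠ 0) :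
    rsChi s = cexp (π * I * s) / (rsQ s * (cexp (π * I * s) + 1)) := by
  have hQ := rsQ_mul_cexp_add_one s
  have hG := Complex.Gamma_ne_zero_of_re_pos hs0
  have hC := cos_ne_zero_of_re hs0 hs3 hs1
  have hQ0 := rsQ_ne_zero hs0
  have hE' : cexp (π * I * s) + 1 ≠ 0 := by rwa [add_comm]
  have hexp0 : cexp (π * I * s) ≠ 0 := Complex.exp_ne_zero _
  have hπ : (2 * π : ℂ) ≠ 0 := by simp [Real.pi_ne_zero]
  have hP : (2 * π : ℂ) ^ s * (2 * π) ^ (-s) = 1 := by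
    rw [Complex.cpow_neg, mul_inv_cancel₀]
    exact fun h ↦ hπ ((Complex.cpow_eq_zero_iff _ _).1 h).1
  rw [rsChi, hQ, div_eq_div_iff (mul_ne_zero (mul_ne_zero two_ne_zero hG) hC)
    (by simp only [ne_eq, mul_eq_zero, not_or]; exact ⟨⟨⟨⟨two_ne_zero,
      fun h ↦ hπ ((Complex.cpow_eq_zero_iff _ _).1 h).1⟩, hG⟩, hC⟩, hexp0⟩)]
  linear_combination (2 * Complex.Gamma s * Complex.cos (↑π * s / 2) * cexp (↑π * I * s)) * hP

/-- **The Riemann–Siegel integral formula for `2 < σ < 3`** (Siegel 1932, eqs. (55)–(56), mirror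
image): `ζ(s) = 𝓡(s) + χ(s) K(s)`, `K(s) = conj 𝓡(1−s̄)`. Obtained by multiplying Riemann's
evaluation of Mordell's integral (`mordellPsi_eq`) at `w = rv` by `w^{s−1}` and integrating over
`r ∈ (0,∞)`: Term A `= −Q𝓡`, Term B `= −Qζ`, Term C `= −K/(1+e^{−πis})`. [cite: Siegel1932, §3 eq. (56)] -/
theorem riemannZeta_eq_of_two_lt_re {s : ℂ} (hs2 : 2 < s.re) (hs3 : s.re < 3) :
    riemannZeta s = riemannAux s + rsChi s * riemannAuxConj s := by
  have hs0 : 0 < s.re := by linarith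
  have hs1 : 1 < s.re := by linarith
  have hsne1 : s ≠ 1 := fun h ↦ by rw [h] at hs2; norm_num at hs2
  -- the three integrands
  set fA : ℝ → ℂ := fun r ↦ ((r : ℂ) * rayDir) ^ (s - 1) * mordellPsi (1 / 2) ((r : ℂ) * rayDir) * rayDir
    with hfA
  set fB : ℝ → ℂ := fun r ↦ ((r : ℂ) * rayDir) ^ (s - 1) /
    (1 - cexp (-(2 * π * I * ((r : ℂ) * rayDir)))) * rayDir with hfB
  set fC : ℝ → ℂ := fun r ↦ ((r : ℂ) * rayDir) ^ (s - 1) * cexp (-(π * I * ((r : ℂ) * rayDir) ^ 2)) /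
    (2 * I * Complex.sin (π * ((r : ℂ) * rayDir))) * rayDir with hfC
  -- Mordell's formula along the ray: `fA = fB - fC`
  have hM : ∀ r ∈ Ioi (0 : ℝ), fA r = fB r - fC r := by
    intro r hr
    have hw : ∀ n : ℤ, (r : ℂ) * rayDir ≠ n := by
      intro n h
      have him := congrArg Complex.im h
      simp [rayDir] at him
      have hr' : (0 : ℝ) < r := hr
      linarith
    simp only [hfA, hfB, hfC, mordellPsi_eq hw]
    ring
  -- integrability of `fA` (Fubini) and `fC`, hence of `fB`
  have hAint : IntegrableOn fA (Ioi 0) := by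
    have h := (integrable_rayTermA hs0).integral_prod_left
    have h2 : IntegrableOn (fun r : ℝ ↦ ((1 + I) * rayDir) * ∫ u : ℝ, ((r : ℂ) * rayDir) ^ (s - 1) *
        mordellKernel ((r : ℂ) * rayDir) (line (1 / 2) u)) (Ioi 0) := h.const_mul _
    refine h2.congr_fun (fun r _ ↦ ?_) measurableSet_Ioi
    simp only [hfA, mordellPsi]
    rw [MeasureTheory.integral_const_mul]; ring
  have hCint : IntegrableOn fC (Ioi 0) := integrableOn_rayKernelC hs2
  have hBint : IntegrableOn fB (Ioi 0) := by
    have := hAint.add hCint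
    refine this.congr_fun (fun r hr ↦ ?_) measurableSet_Ioi
    simp only [Pi.add_apply, hM r hr]; ring
  -- integrate
  have hA : ∫ r in Ioi (0 : ℝ), fA r = -rsQ s * riemannAux s := integral_rayKernelA hs0
  have hB : ∫ r in Ioi (0 : ℝ), fB r = -rsQ s * riemannZeta s := integral_rayKernelB hs1
  have hC : ∫ r in Ioi (0 : ℝ), fC r = -rayDir * cexp (π * I * s) *
      conj (∫ r in Ioi (0 : ℝ), rsKernel (1 - conj s) (line 0 r)) := integral_rayKernelC s
  have hK := riemannAuxConj_eq hs2
  have hABC : ∫ r in Ioi (0 : ℝ), fA r = (∫ r in Ioi (0 : ℝ), fB r) - ∫ r in Ioi (0 : ℝ), fC r := by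
    rw [← integral_sub hBint hCint]
    exact setIntegral_congr_fun measurableSet_Ioi hM
  rw [hA, hB, hC] at hABC
  -- algebra
  have hE : 1 + cexp (π * I * s) ≠ 0 := one_add_cexp_ne_zero hs2 hs3
  have hQ0 := rsQ_ne_zero hs0
  have hchi := rsChi_eq hs0 hs3 hsne1 hE
  set c : ℂ := conj (∫ r in Ioi (0 : ℝ), rsKernel (1 - conj s) (line 0 r)) with hc
  set E : ℂ := cexp (π * I * s) with hEdef
  have hE' : E + 1 ≠ 0 := by rwa [add_comm]
  have hζ : riemannZeta s = riemannAux s + rayDir * E * c / rsQ s := by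
    field_simp
    linear_combination hABC
  rw [hζ, hchi, hK, rayDir]
  field_simp
  ring

/-! ## Analytic continuation to `0 < σ < 3` -/

/-- `χ` is differentiable on `{0 < σ < 3} ∖ {1}`. [folklore] -/
lemma differentiableAt_rsChi {s : ℂ} (hs0 : 0 < s.re) (hs3 : s.re < 3) (hs1 : s ≠ 1) :
    DifferentiableAt ℂ rsChi s := by
  have hG : DifferentiableAt ℂ Complex.Gamma s :=
    Complex.differentiableAt_Gamma s fun m h ↦ by
      have := congrArg Complex.re h; simp at this; linarith
  have h1 : DifferentiableAt ℂ (fun z : ℂ ↦ (2 * π : ℂ) ^ z) s :=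
    differentiableAt_id.const_cpow (Or.inl (by simp [Real.pi_ne_zero]))
  have h2 : DifferentiableAt ℂ (fun z : ℂ ↦ 2 * Complex.Gamma z * Complex.cos (π * z / 2)) s :=
    (hG.const_mul _).mul (by fun_prop)
  have h3 : (2 * Complex.Gamma s * Complex.cos (π * s / 2)) ≠ 0 :=
    mul_ne_zero (mul_ne_zero two_ne_zero (Complex.Gamma_ne_zero_of_re_pos hs0)) (cos_ne_zero_of_re hs0 hs3 hs1)
  exact h1.div h2 h3

/-- `K(s) = conj 𝓡(1 − s̄)` is entire. [folklore] -/
lemma differentiable_riemannAuxConj : Differentiable ℂ riemannAuxConj := by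
  intro s
  have h1 : riemannAuxConj = (conj ∘ riemannAux ∘ conj) ∘ fun z : ℂ ↦ 1 - z := by
    funext z; simp [riemannAuxConj, Function.comp]
  rw [h1]
  refine DifferentiableAt.comp s ?_ (by fun_prop)
  exact differentiableAt_conj_conj_iff.2 (differentiable_riemannAux _)

/-- The region `{0 < σ < 3} ∖ {1}` is preconnected (union of four overlapping convex pieces).
[folklore] -/
lemma isPreconnected_strip_minus_one :
    IsPreconnected {s : ℂ | 0 < s.re ∧ s.re < 3 ∧ s ≠ 1} := by
  set V₁ : Set ℂ := {s : ℂ | 0 < s.re} ∩ {s : ℂ | s.re < 1}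
  set V₂ : Set ℂ := {s : ℂ | 1 < s.re} ∩ {s : ℂ | s.re < 3}
  set V₃ : Set ℂ := ({s : ℂ | 0 < s.re} ∩ {s : ℂ | s.re < 3}) ∩ {s : ℂ | 0 < s.im}
  set V₄ : Set ℂ := ({s : ℂ | 0 < s.re} ∩ {s : ℂ | s.re < 3}) ∩ {s : ℂ | s.im < 0}
  have c₁ : IsPreconnected V₁ := ((convex_halfSpace_re_gt 0).inter (convex_halfSpace_re_lt 1)).isPreconnected
  have c₂ : IsPreconnected V₂ := ((convex_halfSpace_re_gt 1).inter (convex_halfSpace_re_lt 3)).isPreconnected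
  have c₃ : IsPreconnected V₃ :=
    (((convex_halfSpace_re_gt 0).inter (convex_halfSpace_re_lt 3)).inter (convex_halfSpace_im_gt 0)).isPreconnected
  have c₄ : IsPreconnected V₄ :=
    (((convex_halfSpace_re_gt 0).inter (convex_halfSpace_re_lt 3)).inter (convex_halfSpace_im_lt 0)).isPreconnected
  have h13 : IsPreconnected (V₁ ∪ V₃) := by
    refine IsPreconnected.union ((1 / 2 : ℂ) + I) ?_ ?_ c₁ c₃
    · norm_num [V₁]
    · norm_num [V₃]
  have h132 : IsPreconnected ((V₁ ∪ V₃) ∪ V₂) := by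
    refine IsPreconnected.union ((2 : ℂ) + I) ?_ ?_ h13 c₂
    · right; norm_num [V₃]
    · norm_num [V₂]
  have hall : IsPreconnected (((V₁ ∪ V₃) ∪ V₂) ∪ V₄) := by
    refine IsPreconnected.union ((1 / 2 : ℂ) - I) ?_ ?_ h132 c₄
    · left; left; norm_num [V₁]
    · norm_num [V₄]
  convert hall using 1
  ext s
  simp only [Set.mem_setOf_eq, Set.mem_union, Set.mem_inter_iff, V₁, V₂, V₃, V₄]
  constructor
  · rintro ⟨h0, h3, h1⟩
    rcases lt_trichotomy s.im 0 with him | him | him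
    · exact Or.inr ⟨⟨h0, h3⟩, him⟩
    · have hre : s.re ≠ 1 := fun h ↦ h1 (Complex.ext (by simp [h]) (by simp [him]))
      rcases lt_or_gt_of_ne hre with h | h
      · exact Or.inl (Or.inl (Or.inl ⟨h0, h⟩))
      · exact Or.inl (Or.inr ⟨h, h3⟩)
    · exact Or.inl (Or.inl (Or.inr ⟨⟨h0, h3⟩, him⟩))
  · rintro (((⟨h0, h1⟩ | ⟨⟨h0, h3⟩, him⟩) | ⟨h1, h3⟩) | ⟨⟨h0, h3⟩, him⟩)
    · exact ⟨h0, by linarith, fun h ↦ by rw [h] at h1; simp at h1⟩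
    · exact ⟨h0, h3, fun h ↦ by rw [h] at him; simp at him⟩
    · exact ⟨by linarith, h3, fun h ↦ by rw [h] at h1; simp at h1⟩
    · exact ⟨h0, h3, fun h ↦ by rw [h] at him; simp at him⟩

/-- **The Riemann–Siegel integral formula** on `{0 < σ < 3} ∖ {1}` (Siegel 1932, eq. (56);
Titchmarsh (2.10.6); Arias de Reyna, Thm. 5): `ζ(s) = 𝓡(s) + χ(s) conj 𝓡(1 − s̄)`, by analytic
continuation (identity theorem) from the strip `2 < σ < 3`. [cite: Siegel1932, §3 eq. (56)] -/
theorem riemannZeta_eq_riemannAux_add {s : ℂ} (hs0 : 0 < s.re) (hs3 : s.re < 3) (hs1 : s ≠ 1) :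
    riemannZeta s = riemannAux s + rsChi s * riemannAuxConj s := by
  set V : Set ℂ := {s : ℂ | 0 < s.re ∧ s.re < 3 ∧ s ≠ 1} with hV
  have hVopen : IsOpen V := by
    have : V = ({s : ℂ | 0 < s.re} ∩ {s : ℂ | s.re < 3}) ∩ {s : ℂ | s ≠ 1} := by
      ext s; simp [hV, and_assoc]
    rw [this]
    exact ((isOpen_lt continuous_const Complex.continuous_re).inter
      (isOpen_lt Complex.continuous_re continuous_const)).inter isOpen_ne
  set f : ℂ → ℂ := fun s ↦ riemannZeta s - (riemannAux s + rsChi s * riemannAuxConj s) with hf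
  have hdiff : DifferentiableOn ℂ f V := by
    intro z hz
    refine DifferentiableAt.differentiableWithinAt ?_
    exact (differentiableAt_riemannZeta hz.2.2).sub ((differentiable_riemannAux z).add
      ((differentiableAt_rsChi hz.1 hz.2.1 hz.2.2).mul (differentiable_riemannAuxConj z)))
  have hanal := hdiff.analyticOnNhd hVopen
  have hz₀ : ((5 / 2 : ℝ) : ℂ) ∈ V := by
    refine ⟨by norm_num, by norm_num, fun h ↦ ?_⟩
    have := congrArg Complex.re h
    norm_num at this
  have hf0 : f =ᶠ[𝓝 (((5 / 2 : ℝ) : ℂ))] 0 := by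
    have hopen : IsOpen ({s : ℂ | 2 < s.re} ∩ {s : ℂ | s.re < 3}) :=
      (isOpen_lt continuous_const Complex.continuous_re).inter (isOpen_lt Complex.continuous_re continuous_const)
    have hmem : ((5 / 2 : ℝ) : ℂ) ∈ {s : ℂ | 2 < s.re} ∩ {s : ℂ | s.re < 3} := by
      constructor
      · norm_num
      · norm_num
    filter_upwards [hopen.mem_nhds hmem] with z hz
    simp only [hf, Pi.zero_apply, riemannZeta_eq_of_two_lt_re hz.1 hz.2, sub_self]
  have h := hanal.eqOn_zero_of_preconnected_of_eventuallyEq_zero isPreconnected_strip_minus_one hz₀ hf0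
    (show s ∈ V from ⟨hs0, hs3, hs1⟩)
  simp only [hf, Pi.zero_apply, sub_eq_zero] at h
  exact h

/-! ## The critical line -/

/-- On the critical line `1 − s̄ = s`, so `K(½+it) = conj 𝓡(½+it)`. [folklore] -/
lemma riemannAuxConj_half (t : ℝ) :
    riemannAuxConj (1 / 2 + t * I) = conj (riemannAux (1 / 2 + t * I)) := by
  rw [riemannAuxConj]
  congr 2
  apply Complex.ext
  · norm_num
  · simp

/-- **`|χ(½ + it)| = 1`**, from the bridge `rsChi = riemannZetaChi` (`sin(π(½+it)) = cosh(πt) ≠ 0`)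
and the tree's `Literature.NumberTheory.LFunctions.norm_riemannZetaChi_half`.
[cite: Titchmarsh1986, §4.17 eq. (4.17.2)] -/
theorem norm_rsChi_half (t : ℝ) : ‖rsChi (1 / 2 + t * I)‖ = 1 := by
  have hsin : Complex.sin (π * (1 / 2 + t * I)) ≠ 0 := by
    rw [mul_add, show (π : ℂ) * (1 / 2) = π / 2 by ring, Complex.sin_add, Complex.sin_pi_div_two,
      Complex.cos_pi_div_two, one_mul, zero_mul, add_zero,
      show (π : ℂ) * (t * I) = (π * t : ℝ) * I by push_cast; ring, Complex.cos_mul_I]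
    exact_mod_cast (Real.cosh_pos (π * t)).ne'
  rw [rsChi_eq_riemannZetaChi hsin]
  exact norm_riemannZetaChi_half t

/-- **Lehman's starting point** (Siegel 1932, eqs. (59)–(60): `φ(s) = 2π^{-s/2}Γ(s/2)𝔣(s)` and
`π^{-s/2}Γ(s/2)ζ(s) = Re φ(s)` on `σ = ½`): on the critical line the zeta function is at most twice
Riemann's auxiliary function, `|ζ(½ + it)| ≤ 2|𝓡(½ + it)|`. [cite: Siegel1932, §3 eqs. (59)–(60)] -/
theorem norm_riemannZeta_half_le_two_mul (t : ℝ) :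
    ‖riemannZeta (1 / 2 + t * I)‖ ≤ 2 * ‖riemannAux (1 / 2 + t * I)‖ := by
  have h := riemannZeta_eq_riemannAux_add (s := 1 / 2 + t * I) (by norm_num) (by norm_num)
    (fun h ↦ by have := congrArg Complex.re h; norm_num at this)
  rw [h, riemannAuxConj_half]
  calc ‖riemannAux (1 / 2 + t * I) + rsChi (1 / 2 + t * I) * conj (riemannAux (1 / 2 + t * I))‖
      ≤ ‖riemannAux (1 / 2 + t * I)‖ + ‖rsChi (1 / 2 + t * I) * conj (riemannAux (1 / 2 + t * I))‖ :=
        norm_add_le _ _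
    _ = 2 * ‖riemannAux (1 / 2 + t * I)‖ := by
        rw [norm_mul, norm_rsChi_half, one_mul, Complex.norm_conj]; ring


/-! ## The residue shift: `𝓡(s) = Σ_{n ≤ N} n^{-s} + ∫_{N↙N+1}` -/

/-- `(-1)ⁿ e^{πin²} = 1` for every integer `n` (`n(n+1)` is even). [folklore] -/
lemma neg_one_zpow_mul_cexp_pi_I_sq (n : ℤ) : (-1 : ℂ) ^ n * cexp (π * I * (n : ℂ) ^ 2) = 1 := by
  have h1 : cexp (π * I * (n : ℂ) ^ 2) = (-1 : ℂ) ^ (n ^ 2) := by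
    rw [show (π : ℂ) * I * (n : ℂ) ^ 2 = ((n ^ 2 : ℤ) : ℂ) * (π * I) by push_cast; ring,
      Complex.exp_int_mul, Complex.exp_pi_mul_I]
  rw [h1, ← zpow_add₀ (by norm_num : (-1 : ℂ) ≠ 0)]
  have heven : Even (n + n ^ 2) := by
    rw [show n + n ^ 2 = n * (n + 1) by ring]; exact Int.even_mul_succ_self n
  exact heven.neg_one_zpow

/-- **Shifting Siegel's line across the poles `1, …, N`** (Siegel 1932, §2; the residue of
`x^{-s}e^{πix²}/(e^{πix} − e^{−πix})` at `x = n` is `n^{-s}/(2πi)`): for `N < c < N + 1`,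
`𝓡(s) = Σ_{n=1}^{N} n^{-s} + J_c(s)`, where `J_c` is the integral over the line of slope one through
`c`. [cite: Siegel1932, §2 eq. (32)] -/
theorem riemannAux_eq_sum_add_rsLineIntegral (s : ℂ) {N : ℕ} (hN : 1 ≤ N) {c : ℝ}
    (hNc : (N : ℝ) < c) (hcN : c < N + 1) :
    riemannAux s = ∑ n ∈ Finset.Icc 1 N, ((n : ℂ)) ^ (-s) + rsLineIntegral c s := by
  have hc0 : 0 < c := lt_of_le_of_lt (Nat.cast_nonneg N) hNc
  have hchalf : (1 : ℝ) / 2 < c := by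
    have : (1 : ℝ) ≤ N := by exact_mod_cast hN
    linarith
  have hcn : ∀ n : ℤ, (n : ℝ) ≠ c := by
    intro n h
    have h1 : (N : ℝ) < n := h ▸ hNc
    have h2 : (n : ℝ) < N + 1 := h ▸ hcN
    have h1' : (N : ℤ) < n := by exact_mod_cast h1
    have h2' : n < N + 1 := by exact_mod_cast h2
    omega
  obtain ⟨d, hd0, hd⟩ := exists_pos_le_abs_sub_int hcn
  -- the numerator `h(x) = x^{-s} e^{πix²}/(2i)` and the residue theorem between `1/2` and `c`
  set h : ℂ → ℂ := fun x ↦ (x ^ (-s) * (2 * I)⁻¹) * cexp (π * I * x ^ 2 + 0 * x) with hh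
  have hker : ∀ x : ℂ, rsKernel s x = h x / Complex.sin (π * x) := fun x ↦ by
    rw [rsKernel_eq]
  set U : Set ℂ := {z : ℂ | 0 < z.re - z.im} with hU
  have hUopen : IsOpen U := isOpen_lt continuous_const (Complex.continuous_re.sub Complex.continuous_im)
  have hKU : {z : ℂ | z.re - z.im ∈ Icc (1 / 2 : ℝ) c} ⊆ U := fun z hz ↦ by
    simp only [hU, Set.mem_setOf_eq]; linarith [hz.1]
  have hhd : DifferentiableOn ℂ h U := by
    intro z hz
    have hz' : z ∈ slitPlane := mem_slitPlane_of_re_sub_im (le_of_lt hz) (fun h0 ↦ by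
      rw [h0] at hz; simp [hU] at hz)
    simp only [hh]
    exact ((differentiableAt_id.cpow_const hz').mul_const _ |>.mul (by fun_prop)).differentiableWithinAt
  have hint : ∀ c' : ℝ, 0 < c' → ∀ d' : ℝ, 0 < d' → (∀ n : ℤ, d' ≤ |c' - n|) →
      Integrable fun u : ℝ ↦ h (line c' u) / Complex.sin (π * line c' u) := by
    intro c' hc' d' hd'0 hd'
    exact (integrable_rsKernel_line s hc' hd'0 hd').congr (Eventually.of_forall fun u ↦ hker _)
  have hdec : ∀ ε : ℝ, 0 < ε → ∃ T₀ : ℝ, ∀ T : ℝ, T₀ ≤ |T| → ∀ c' ∈ Icc (1 / 2 : ℝ) c,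
      ‖h (line c' T) / Complex.sin (π * line c' T)‖ ≤ ε := by
    intro ε hε
    obtain ⟨T₀, hT₀⟩ := decay_rsKernel s (c₁ := 1 / 2) (c₂ := c) (by norm_num) ε hε
    exact ⟨T₀, fun T hT c' hc' ↦ by rw [← hker]; exact hT₀ T hT c' hc'⟩
  have hmain := Literature.Analysis.Complex.integral_slant_div_sin_sub_eq_sum (h := h)
    (c₁ := 1 / 2) (c₂ := c) hchalf int_ne_half hcn U hUopen hKU hhd
    (hint _ (by norm_num) _ (by norm_num) half_le_abs_half_sub_int) (hint c hc0 d hd0 hd) hdec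
  -- evaluate the residue sum
  have hfl1 : ⌊(1 / 2 : ℝ)⌋ = 0 := by norm_num [Int.floor_eq_iff]
  have hfl2 : ⌊c⌋ = N := by
    rw [Int.floor_eq_iff]; exact ⟨by exact_mod_cast hNc.le, by exact_mod_cast hcN⟩
  rw [hfl1, hfl2] at hmain
  have hsum : ∑ n ∈ Finset.Ioc (0 : ℤ) N, (-1 : ℂ) ^ n * h n =
      (2 * I)⁻¹ * ∑ n ∈ Finset.Icc 1 N, ((n : ℂ)) ^ (-s) := by
    rw [Finset.mul_sum]
    -- reindex `Ioc 0 N` (integers) by `Icc 1 N` (naturals)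
    have hset : Finset.Ioc (0 : ℤ) N = (Finset.Icc 1 N).map Nat.castEmbedding := by
      ext m
      simp only [Finset.mem_Ioc, Finset.mem_map, Finset.mem_Icc, Nat.castEmbedding_apply]
      constructor
      · rintro ⟨h0, hN⟩
        refine ⟨m.toNat, ⟨by omega, by omega⟩, by omega⟩
      · rintro ⟨k, ⟨h1, hk⟩, rfl⟩
        exact ⟨by exact_mod_cast h1, by exact_mod_cast hk⟩
    rw [hset, Finset.sum_map]
    refine Finset.sum_congr rfl fun k _ ↦ ?_
    simp only [Nat.castEmbedding_apply, hh, Int.cast_natCast, zero_mul, add_zero]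
    have e := neg_one_zpow_mul_cexp_pi_I_sq (k : ℤ)
    push_cast at e
    linear_combination ((k : ℂ) ^ (-s) * (2 * I)⁻¹) * e
  rw [hsum] at hmain
  -- conclude
  have hI : (1 : ℂ) + I ≠ 0 := Literature.Analysis.Complex.one_add_I_ne_zero
  simp only [riemannAux, rsLineIntegral]
  simp only [hker]
  have hsplit : ∫ u : ℝ, h (line (1 / 2) u) / Complex.sin (π * line (1 / 2) u) =
      (∫ u : ℝ, h (line c u) / Complex.sin (π * line c u)) -
        2 * I / (1 + I) * ((2 * I)⁻¹ * ∑ n ∈ Finset.Icc 1 N, ((n : ℂ)) ^ (-s)) := by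
    linear_combination -hmain
  rw [hsplit]
  field_simp
  ring


end SiegelIntegral

end Literature.NumberTheory.LFunctions
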